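import Summits.QuantumFields.BalabanUV.Beta.GAN24.FourFaceGaugeSectors
import Summits.QuantumFields.BalabanUV.Beta.GAN24.T2RecChargeStep

/-!
# `BalabanUV.Beta.GAN24.FourFaceGaugeSectorsMember` — binder row G-an2-4 ∕ (CONV-C), row (C) at the levels `j ≥ 1`, CONTACT side; Part 2 of
# `GAN24/FourFaceGaugeSectors`: **THE COMB MEMBER IS THE INSTANCE, AT EVERY LEVEL** — its field–field block is covariant under ALL unit translations of
# its own lattice; the three two-pair classes of the sector expansion evaluated (`N⁴·FF = zmode + pair + pair + all four`); the member's four-face charge in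
# pure-gauge sectors, its lonely sectors vanish, its Wilson-charged patterns `(μ,μ;α,α)` reduced to the background pair, the leg pair and the quadruple

NOT IN PRINT; OUR BOOKKEEPING (G-an2-4 crux team (2), leaf prover `b2b-balaban-gan24-formalise-leaf-02`, gen 64; journal INTENT I-leaf02-g64-2).  WHY.  Part 1
(`FourFaceGaugeSectors`) expands the four-face charge of any `LocStencil₂` table with UNIT-covariant ff block into pure-gauge sectors and kills the lonely ones.
The comb member `T̃_j = unitS₂_j (T2RecAt … j)` as a whole table is only `Lc`-covariant (p2's `T2RecChargeStep.member_translate`: the rooted border `vh₂S` and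
the rooted dressing are block-periodic), but its FIELD–FIELD block — all the zero modes read — is covariant under EVERY unit translation of the member's own
lattice: member `0` is an3's `wilsonW₂` (`wilsonW₂_translate`, all fine shifts) plus a border with zero ff block; member `j+1` is an2's `e4OfKW` read-out, whose
index and leg lattice is the COARSE one, so a unit shift there is an `Lc`-shift of its four `Lc`-covariant inputs (`e4OfKW_translate` over
`shiftK_coDressKBmAt_KInvStep`, `SpureRecAt_translate`, `M1At_translate`, `WrecAt_translate` with an1's `hmixt_an1`), plus the same border.  Hence Part 1
applies to `T̃_j` VERBATIM at the period `N := Lc`, every `j`: the four-face term of p2's `T2RecChargeStepFourFace.zmode_succ_eq_fourFace` is the alternating sum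
of the sixteen pure-gauge sectors of `T̃_j`, the lonely ones vanish, and on the Wilson-charged patterns `(μ,μ;α,α)` (the engine's `(00;11)`) exactly the
background pair `T̃_j[dλ_μ,dλ_μ; c̃,c̃]`, the leg pair `T̃_j[c̃,c̃; dλ_α,dλ_α]` and the four-insertion sector survive — LAW A's live sectors of the t2 word
(my g62 memo §5c: `+2u, +2u, +4u` at level 0; `+3.6u, +3.6u, +12.96u` at level 1, D = 2), now located by a KERNEL theorem at every level, generic `d`.

WHAT (generic `d`, `1 ≤ Lc`, in-block root `toSite r`; a generic jointly `Lc`-covariant `LocStencil₂` border `vh₂S` with zero ff block (p2's `hBff`, `hB`, `hBt`);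
[folklore] composition BY NAME; one finite check by `decide` per class; 0 `def`, 0 cited facts, 0 `def … : Prop`, 0 sorry):
* §1 **`member_ff_translate`** — `T̃_j κ (u+t) κ′ (u′+t) x z (inl α) (inl β) = shiftK (−t) (T̃_j κ u κ′ u′) x z (inl α) (inl β)`, every `j`, every unit `t`.
* §2 (generic `Y` as in Part 1) `sum_powerset_eq_sum_of_vanish`; the lonely members of the three two-pair classes by `decide` (`lonely_of_pairs_01_23 ∕ _02_13 ∕ _03_12`),
  the direction ↦ class maps (`class_of_dir_pairs_bg_leg ∕ _cross ∕ _swap`, `κ ≠ a`), and the evaluations **`fourFace_mul_eq_of_pairs_bg_leg`** (`(κ,κ;a,a)`: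
  `N⁴·FF = zmode + Sector_{01} + Sector_{23} + Sector_{0123}`), **`fourFace_mul_eq_of_pairs_cross`** (`(κ,a;κ,a)`: `{02}, {13}`), **`fourFace_mul_eq_of_pairs_swap`**
  (`(κ,a;a,κ)`: `{03}, {12}`).
* §3 the member: **`member_fourFace_mul_eq_sum_sectors`** (p2's literal four-face term of `T̃_j` = the alternating sector sum, every `j`), **`member_sector_eq_zero_of_lonely`**,
  **`member_fourFace_mul_eq_of_pairs_bg_leg`** (`(μ,μ;α,α)`, `μ ≠ α`).
HONEST FRAMING (cell contract, verbatim): «discharging `BetaPertH` makes Bałaban's UV stability UNCONDITIONAL — a real constructive-QFT result; it is NOT the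
continuum limit and NOT the Clay problem.»  HONEST DEPENDENCY (verbatim): «continuum YM on T⁴ ⇐ BetaPertH ∧ nine spine estimates (0/9 proved); BetaPertH ⇐ (D1) ∧
(D4) ∧ CAP+tail; G-an2-4 gates asym, D1 and NE2/3/4.»  Bookkeeping only: NO Ward content, NO estimate of Bałaban's; discharges NOTHING of (C) ∕ (C)sym ∕ (Q-L) ∕
«T2Shape» ∕ «T2Drift» ∕ (hW, hWall); 0 wall binders; NEVER «G-an2-4 closed» as (CONV-C); NOT D1, NOT BetaPertH, NOT continuum, NOT Clay.  2026-08-23.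
-/

noncomputable section

open Finset
open scoped BigOperators
open Literature.MathematicalPhysics.QuantumFieldTheory
open Literature.MathematicalPhysics.QuantumFieldTheory.Balaban1983to89
open Literature.MathematicalPhysics.QuantumFieldTheory.Balaban1983to89.Beta
open ExpKernelCalculus (MKer shiftK)
open OneStepResolventKernel (Fib)
open OneStepKernelFamily (KInvStep)
open AffineAveraging (Site box toSite)
open BalabanCompositeJets (LocStencil₂)
open WilsonBiStencil (wilsonW₂ wilsonW₂_translate)
open AveragingMixedJetTables (mixFFAt)
open Summit.QuantumFields.BalabanUV.Beta.SecondOrderUnits (unitS₂)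
open Summit.QuantumFields.BalabanUV.Beta.AxialDressingRooted (coDressKBmAt shiftK_coDressKBmAt_KInvStep)
open Summit.QuantumFields.BalabanUV.Beta.SpineRooted (T2RecAt SpureRecAt M1At WrecAt e4OfKW T2RecAt_zero_level T2RecAt_succ e4OfKW_translate
  SpureRecAt_translate M1At_translate WrecAt_translate)
open Summit.QuantumFields.BalabanUV.Beta.MixedJetTablesPlug (hmixt_an1)
open Summit.QuantumFields.BalabanUV.Beta.GAN24.CombesThomas (sfStep smStep)
open Summit.QuantumFields.BalabanUV.Beta.GAN24.T2SlotUnits (unitS₂_apply)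
open Summit.QuantumFields.BalabanUV.Beta.GAN24.BiStencilZeroMode (Tab zmode)
open Summit.QuantumFields.BalabanUV.Beta.GAN24.T2RecChargeStep (shape_member)
open Summit.QuantumFields.BalabanUV.Beta.GAN24.FourFaceGaugeSectors (fourFace_mul_eq_sum_sectors sector_empty sector_eq_zero_of_lonely)

namespace Summit.QuantumFields.BalabanUV.Beta.GAN24.FourFaceGaugeSectorsMember

variable {d : ℕ} {N : ℕ} {Lc : ℕ} [NeZero Lc] {r : Fin (d + 1) → ℕ}

/-! ## §1 The field–field block of every comb member is covariant under ALL unit translations of its own lattice -/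

/-- NOT IN PRINT; OUR BOOKKEEPING.  **THE ff BLOCK OF THE COMB MEMBER IS UNIT-COVARIANT AT EVERY LEVEL** (in-block root `toSite r`; a generic jointly
`Lc`-covariant border `vh₂S` with vanishing field–field block): for every `j` and every unit translation `t` of the member's own lattice,
`T̃_j κ (u + t) κ′ (u′ + t) x z (inl α) (inl β) = T̃_j κ u κ′ u′ (x − t) (z − t) (inl α) (inl β)`.  Member `0`: an3's `wilsonW₂_translate` (all fine
translations); member `j+1`: an2's `e4OfKW_translate` AT UNIT SHIFTS over the `Lc`-block covariance of its four inputs (`shiftK_coDressKBmAt_KInvStep`,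
`SpureRecAt_translate`, `M1At_translate`, `WrecAt_translate` with an1's `hmixt_an1`) — the read-out lattice of `e4OfKW` is the COARSE one, so a unit shift
there is an `Lc`-shift of the inputs; the border contributes `0` to the ff block on both sides.  (The member as a whole table is only `Lc`-covariant:
p2's `T2RecChargeStep.member_translate`.) -/
theorem member_ff_translate (hLc : 1 ≤ Lc) (cE cVH cΛ cE₂ cB : ℝ) (Tc : Fin 4 → Fin 4 → Fin 4 → Fin 4 → ℝ) {vh₂S : Tab d}
    (hBff : ∀ κ u κ' u' x z (α β : Fin (d + 1)), vh₂S κ u κ' u' x z (Sum.inl α) (Sum.inl β) = 0)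
    (hBt : ∀ (κ : Fin (d + 1)) (u : Fin (d + 1) → ℤ) (κ' : Fin (d + 1)) (u' t : Fin (d + 1) → ℤ),
      vh₂S κ (u + (Lc : ℤ) • t) κ' (u' + (Lc : ℤ) • t) = shiftK (-((Lc : ℤ) • t)) (vh₂S κ u κ' u'))
    (j : ℕ) (κ : Fin (d + 1)) (u : Site (d + 1)) (κ' : Fin (d + 1)) (u' t x z : Site (d + 1)) (α β : Fin (d + 1)) :
    unitS₂ (sfStep Lc j) (smStep d Lc j) (T2RecAt d Lc (toSite r) cE cVH cΛ cE₂ cB Tc vh₂S (mixFFAt (toSite r) Lc) j) κ (u + t) κ' (u' + t) x z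
        (Sum.inl α) (Sum.inl β)
      = shiftK (-t) (unitS₂ (sfStep Lc j) (smStep d Lc j) (T2RecAt d Lc (toSite r) cE cVH cΛ cE₂ cB Tc vh₂S (mixFFAt (toSite r) Lc) j) κ u κ' u') x z
        (Sum.inl α) (Sum.inl β) := by
  cases j with
  | zero =>
    have hw := wilsonW₂_translate (d := d) (T := Tc) κ u κ' u' t
    simp only [shiftK, unitS₂_apply, T2RecAt_zero_level, Pi.add_apply, Pi.smul_apply, smul_eq_mul, hBff, mul_zero, add_zero, hw]
  | succ j =>
    have he := e4OfKW_translate (Lc := Lc) (shiftK_coDressKBmAt_KInvStep (d := d) (toSite r) j) (SpureRecAt_translate (toSite r) hLc cE cVH cΛ j)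
      (M1At_translate (Lc := Lc) (toSite r) cΛ j)
      (WrecAt_translate (toSite r) cE cVH cΛ cE₂ cB Tc vh₂S (mixFFAt (toSite r) Lc) hLc hBt (hmixt_an1 (toSite r)) j) κ u κ' u' t
    simp only [shiftK, unitS₂_apply, T2RecAt_succ, Pi.add_apply, Pi.smul_apply, smul_eq_mul, hBff, mul_zero, add_zero, he]

/-! ## §2 The two-pair classes: the alternating sum has exactly four live terms -/

/-- [folklore] Restricting the alternating sector sum to a family `T` outside which the terms vanish. -/
theorem sum_powerset_eq_sum_of_vanish (f : Finset (Fin 4) → ℝ) (T : Finset (Finset (Fin 4))) (hf : ∀ S, S ∉ T → f S = 0) :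
    ∑ S ∈ (Finset.univ : Finset (Fin 4)).powerset, f S = ∑ S ∈ T, f S :=
  (Finset.sum_subset (fun S _ => Finset.mem_powerset.2 (Finset.subset_univ S)) fun S _ hS => hf S hS).symm

/-- [folklore] The lonely members of the two-pair class `(0,0,1,1)`: outside `{∅, {0,1}, {2,3}, univ}` every subset of the four slots has a member whose
class no other member shares (a finite check). -/
theorem lonely_of_pairs_01_23 : ∀ S : Finset (Fin 4), S ∉ ({∅, {0, 1}, {2, 3}, Finset.univ} : Finset (Finset (Fin 4))) →
    ∃ s₀ ∈ S, ∀ s ∈ S, (![0, 0, 1, 1] : Fin 4 → Fin 2) s = (![0, 0, 1, 1] : Fin 4 → Fin 2) s₀ → s = s₀ := by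
  decide

/-- [folklore] In the class `(κ,κ;a,a)` with `κ ≠ a` two slots face the same direction iff they lie in the same pair. -/
theorem class_of_dir_pairs_bg_leg {κ a : Fin (d + 1)} (hκa : κ ≠ a) (s s₀ : Fin 4)
    (h : (![κ, κ, a, a] : Fin 4 → Fin (d + 1)) s = (![κ, κ, a, a] : Fin 4 → Fin (d + 1)) s₀) :
    (![0, 0, 1, 1] : Fin 4 → Fin 2) s = (![0, 0, 1, 1] : Fin 4 → Fin 2) s₀ := by
  fin_cases s <;> fin_cases s₀ <;> simp [hκa, hκa.symm] at h ⊢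

/-- NOT IN PRINT; OUR BOOKKEEPING.  **THE WILSON-CHARGED CLASS `(κ,κ;a,a)`, `κ ≠ a`** (both background slots face `κ`, both legs face `a`; `Y` as in Part 1):
`N⁴·FF_N(Y)(κ,κ;a,a) = zmode N Y κ κ (inl α) (inl β) + Sector_{{0,1}} + Sector_{{2,3}} + Sector_{{0,1,2,3}}` — the BACKGROUND PAIR (`Y[dλ_κ, dλ_κ; c̃, c̃]`), the
LEG PAIR (`Y[c̃, c̃; dλ_a, dλ_a]`) and the four-insertion sector are the only survivors; the twelve other sectors are lonely (my g62 memo §5c: «#g = 2 same-direction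
pairs live, mixed pairs and odd insertions vanish» for the t2 word, every level). -/
theorem fourFace_mul_eq_of_pairs_bg_leg (hN : 1 ≤ N) {Y : Tab d} {C δ : ℝ} (hY : LocStencil₂ Y C δ) (hδ : 0 < δ)
    (h1 : ∀ κ u κ' u' (t x z : Site (d + 1)) (α β : Fin (d + 1)),
      Y κ (u + t) κ' (u' + t) x z (Sum.inl α) (Sum.inl β) = shiftK (-t) (Y κ u κ' u') x z (Sum.inl α) (Sum.inl β))
    {κ a : Fin (d + 1)} (hκa : κ ≠ a) (α β : Fin (d + 1)) :
    (N : ℝ) ^ 4 * ∑ rr ∈ box (d + 1) N, ∑' u' : Site (d + 1), ∑' x : Site (d + 1), ∑' z : Site (d + 1),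
        (if toSite rr κ % (N : ℤ) = (N : ℤ) - 1 ∧ u' κ % (N : ℤ) = (N : ℤ) - 1 ∧ x a % (N : ℤ) = (N : ℤ) - 1 ∧ z a % (N : ℤ) = (N : ℤ) - 1
          then Y κ (toSite rr) κ u' x z (Sum.inl α) (Sum.inl β) else 0)
      = zmode N Y κ κ (Sum.inl α) (Sum.inl β)
        + ∑ rr ∈ box (d + 1) N, ∑' u' : Site (d + 1), ∑' x : Site (d + 1), ∑' z : Site (d + 1),
            (∏ s ∈ ({0, 1} : Finset (Fin 4)), (1 - (N : ℝ) * (if (![toSite rr, u', x, z] : Fin 4 → Site (d + 1)) s ((![κ, κ, a, a] : Fin 4 → Fin (d + 1)) s) % (N : ℤ) = (N : ℤ) - 1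
              then (1 : ℝ) else 0))) * Y κ (toSite rr) κ u' x z (Sum.inl α) (Sum.inl β)
        + ∑ rr ∈ box (d + 1) N, ∑' u' : Site (d + 1), ∑' x : Site (d + 1), ∑' z : Site (d + 1),
            (∏ s ∈ ({2, 3} : Finset (Fin 4)), (1 - (N : ℝ) * (if (![toSite rr, u', x, z] : Fin 4 → Site (d + 1)) s ((![κ, κ, a, a] : Fin 4 → Fin (d + 1)) s) % (N : ℤ) = (N : ℤ) - 1
              then (1 : ℝ) else 0))) * Y κ (toSite rr) κ u' x z (Sum.inl α) (Sum.inl β)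
        + ∑ rr ∈ box (d + 1) N, ∑' u' : Site (d + 1), ∑' x : Site (d + 1), ∑' z : Site (d + 1),
            (∏ s ∈ (Finset.univ : Finset (Fin 4)), (1 - (N : ℝ) * (if (![toSite rr, u', x, z] : Fin 4 → Site (d + 1)) s ((![κ, κ, a, a] : Fin 4 → Fin (d + 1)) s) % (N : ℤ) = (N : ℤ) - 1
              then (1 : ℝ) else 0))) * Y κ (toSite rr) κ u' x z (Sum.inl α) (Sum.inl β) := by
  rw [fourFace_mul_eq_sum_sectors hN hY hδ h1 κ κ a a α β,
    sum_powerset_eq_sum_of_vanish _ ({∅, {0, 1}, {2, 3}, Finset.univ} : Finset (Finset (Fin 4))) ?van]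
  · rw [Finset.sum_insert (by decide), Finset.sum_insert (by decide), Finset.sum_insert (by decide), Finset.sum_singleton,
      sector_empty]
    have c01 : (({0, 1} : Finset (Fin 4)).card : ℕ) = 2 := by decide
    have c23 : (({2, 3} : Finset (Fin 4)).card : ℕ) = 2 := by decide
    rw [Finset.card_empty, c01, c23, Finset.card_univ, Fintype.card_fin, pow_zero, neg_one_sq, show ((-1 : ℝ)) ^ 4 = 1 by norm_num]
    simp only [one_mul, add_assoc]
  · intro S hS
    obtain ⟨s₀, hs₀, hl⟩ := lonely_of_pairs_01_23 S hS
    rw [sector_eq_zero_of_lonely hN hY hδ h1 κ κ a a α β S hs₀ (fun s hs h => hl s hs (class_of_dir_pairs_bg_leg hκa s s₀ h)), mul_zero]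

/-- [folklore] The lonely members of the two-pair class `(0,1,0,1)`: outside `{∅, {0,1}, {2,3}, univ}` every subset of the four slots has a member whose
class no other member shares (a finite check). -/
theorem lonely_of_pairs_02_13 : ∀ S : Finset (Fin 4), S ∉ ({∅, {0, 2}, {1, 3}, Finset.univ} : Finset (Finset (Fin 4))) →
    ∃ s₀ ∈ S, ∀ s ∈ S, (![0, 1, 0, 1] : Fin 4 → Fin 2) s = (![0, 1, 0, 1] : Fin 4 → Fin 2) s₀ → s = s₀ := by
  decide

/-- [folklore] In the class `(κ,κ;a,a)` with `κ ≠ a` two slots face the same direction iff they lie in the same pair. -/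
theorem class_of_dir_pairs_cross {κ a : Fin (d + 1)} (hκa : κ ≠ a) (s s₀ : Fin 4)
    (h : (![κ, a, κ, a] : Fin 4 → Fin (d + 1)) s = (![κ, a, κ, a] : Fin 4 → Fin (d + 1)) s₀) :
    (![0, 1, 0, 1] : Fin 4 → Fin 2) s = (![0, 1, 0, 1] : Fin 4 → Fin 2) s₀ := by
  fin_cases s <;> fin_cases s₀ <;> simp [hκa, hκa.symm] at h ⊢

/-- NOT IN PRINT; OUR BOOKKEEPING.  **THE CROSSED CLASS `(κ,a;κ,a)`, `κ ≠ a`** (first background slot and first leg face `κ`, second background slot and second leg face `a`):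
`N⁴·FF_N(Y)(κ,a;κ,a) = zmode N Y κ a (inl α) (inl β) + Sector_{{0,2}} + Sector_{{1,3}} + Sector_{{0,1,2,3}}` — the two same-direction (background, leg) slot pairs and the
four-insertion sector survive (memo §5c: pattern `(0,1;0,1)`, «the live pairs = the same-direction slot pairs»). -/
theorem fourFace_mul_eq_of_pairs_cross (hN : 1 ≤ N) {Y : Tab d} {C δ : ℝ} (hY : LocStencil₂ Y C δ) (hδ : 0 < δ)
    (h1 : ∀ κ u κ' u' (t x z : Site (d + 1)) (α β : Fin (d + 1)),
      Y κ (u + t) κ' (u' + t) x z (Sum.inl α) (Sum.inl β) = shiftK (-t) (Y κ u κ' u') x z (Sum.inl α) (Sum.inl β))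
    {κ a : Fin (d + 1)} (hκa : κ ≠ a) (α β : Fin (d + 1)) :
    (N : ℝ) ^ 4 * ∑ rr ∈ box (d + 1) N, ∑' u' : Site (d + 1), ∑' x : Site (d + 1), ∑' z : Site (d + 1),
        (if toSite rr κ % (N : ℤ) = (N : ℤ) - 1 ∧ u' a % (N : ℤ) = (N : ℤ) - 1 ∧ x κ % (N : ℤ) = (N : ℤ) - 1 ∧ z a % (N : ℤ) = (N : ℤ) - 1
          then Y κ (toSite rr) a u' x z (Sum.inl α) (Sum.inl β) else 0)
      = zmode N Y κ a (Sum.inl α) (Sum.inl β)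
        + ∑ rr ∈ box (d + 1) N, ∑' u' : Site (d + 1), ∑' x : Site (d + 1), ∑' z : Site (d + 1),
            (∏ s ∈ ({0, 2} : Finset (Fin 4)), (1 - (N : ℝ) * (if (![toSite rr, u', x, z] : Fin 4 → Site (d + 1)) s ((![κ, a, κ, a] : Fin 4 → Fin (d + 1)) s) % (N : ℤ) = (N : ℤ) - 1
              then (1 : ℝ) else 0))) * Y κ (toSite rr) a u' x z (Sum.inl α) (Sum.inl β)
        + ∑ rr ∈ box (d + 1) N, ∑' u' : Site (d + 1), ∑' x : Site (d + 1), ∑' z : Site (d + 1),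
            (∏ s ∈ ({1, 3} : Finset (Fin 4)), (1 - (N : ℝ) * (if (![toSite rr, u', x, z] : Fin 4 → Site (d + 1)) s ((![κ, a, κ, a] : Fin 4 → Fin (d + 1)) s) % (N : ℤ) = (N : ℤ) - 1
              then (1 : ℝ) else 0))) * Y κ (toSite rr) a u' x z (Sum.inl α) (Sum.inl β)
        + ∑ rr ∈ box (d + 1) N, ∑' u' : Site (d + 1), ∑' x : Site (d + 1), ∑' z : Site (d + 1),
            (∏ s ∈ (Finset.univ : Finset (Fin 4)), (1 - (N : ℝ) * (if (![toSite rr, u', x, z] : Fin 4 → Site (d + 1)) s ((![κ, a, κ, a] : Fin 4 → Fin (d + 1)) s) % (N : ℤ) = (N : ℤ) - 1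
              then (1 : ℝ) else 0))) * Y κ (toSite rr) a u' x z (Sum.inl α) (Sum.inl β) := by
  rw [fourFace_mul_eq_sum_sectors hN hY hδ h1 κ a κ a α β,
    sum_powerset_eq_sum_of_vanish _ ({∅, {0, 2}, {1, 3}, Finset.univ} : Finset (Finset (Fin 4))) ?van]
  · rw [Finset.sum_insert (by decide), Finset.sum_insert (by decide), Finset.sum_insert (by decide), Finset.sum_singleton,
      sector_empty]
    have c01 : (({0, 2} : Finset (Fin 4)).card : ℕ) = 2 := by decide
    have c23 : (({1, 3} : Finset (Fin 4)).card : ℕ) = 2 := by decide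
    rw [Finset.card_empty, c01, c23, Finset.card_univ, Fintype.card_fin, pow_zero, neg_one_sq, show ((-1 : ℝ)) ^ 4 = 1 by norm_num]
    simp only [one_mul, add_assoc]
  · intro S hS
    obtain ⟨s₀, hs₀, hl⟩ := lonely_of_pairs_02_13 S hS
    rw [sector_eq_zero_of_lonely hN hY hδ h1 κ a κ a α β S hs₀ (fun s hs h => hl s hs (class_of_dir_pairs_cross hκa s s₀ h)), mul_zero]

/-- [folklore] The lonely members of the two-pair class `(0,1,1,0)`: outside `{∅, {0,1}, {2,3}, univ}` every subset of the four slots has a member whose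
class no other member shares (a finite check). -/
theorem lonely_of_pairs_03_12 : ∀ S : Finset (Fin 4), S ∉ ({∅, {0, 3}, {1, 2}, Finset.univ} : Finset (Finset (Fin 4))) →
    ∃ s₀ ∈ S, ∀ s ∈ S, (![0, 1, 1, 0] : Fin 4 → Fin 2) s = (![0, 1, 1, 0] : Fin 4 → Fin 2) s₀ → s = s₀ := by
  decide

/-- [folklore] In the class `(κ,κ;a,a)` with `κ ≠ a` two slots face the same direction iff they lie in the same pair. -/
theorem class_of_dir_pairs_swap {κ a : Fin (d + 1)} (hκa : κ ≠ a) (s s₀ : Fin 4)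
    (h : (![κ, a, a, κ] : Fin 4 → Fin (d + 1)) s = (![κ, a, a, κ] : Fin 4 → Fin (d + 1)) s₀) :
    (![0, 1, 1, 0] : Fin 4 → Fin 2) s = (![0, 1, 1, 0] : Fin 4 → Fin 2) s₀ := by
  fin_cases s <;> fin_cases s₀ <;> simp [hκa, hκa.symm] at h ⊢

/-- NOT IN PRINT; OUR BOOKKEEPING.  **THE SWAPPED CLASS `(κ,a;a,κ)`, `κ ≠ a`** (first background slot and second leg face `κ`, second background slot and first leg face `a`):
`N⁴·FF_N(Y)(κ,a;a,κ) = zmode N Y κ a (inl α) (inl β) + Sector_{{0,3}} + Sector_{{1,2}} + Sector_{{0,1,2,3}}` (memo §5c: pattern `(0,1;1,0)`). -/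
theorem fourFace_mul_eq_of_pairs_swap (hN : 1 ≤ N) {Y : Tab d} {C δ : ℝ} (hY : LocStencil₂ Y C δ) (hδ : 0 < δ)
    (h1 : ∀ κ u κ' u' (t x z : Site (d + 1)) (α β : Fin (d + 1)),
      Y κ (u + t) κ' (u' + t) x z (Sum.inl α) (Sum.inl β) = shiftK (-t) (Y κ u κ' u') x z (Sum.inl α) (Sum.inl β))
    {κ a : Fin (d + 1)} (hκa : κ ≠ a) (α β : Fin (d + 1)) :
    (N : ℝ) ^ 4 * ∑ rr ∈ box (d + 1) N, ∑' u' : Site (d + 1), ∑' x : Site (d + 1), ∑' z : Site (d + 1),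
        (if toSite rr κ % (N : ℤ) = (N : ℤ) - 1 ∧ u' a % (N : ℤ) = (N : ℤ) - 1 ∧ x a % (N : ℤ) = (N : ℤ) - 1 ∧ z κ % (N : ℤ) = (N : ℤ) - 1
          then Y κ (toSite rr) a u' x z (Sum.inl α) (Sum.inl β) else 0)
      = zmode N Y κ a (Sum.inl α) (Sum.inl β)
        + ∑ rr ∈ box (d + 1) N, ∑' u' : Site (d + 1), ∑' x : Site (d + 1), ∑' z : Site (d + 1),
            (∏ s ∈ ({0, 3} : Finset (Fin 4)), (1 - (N : ℝ) * (if (![toSite rr, u', x, z] : Fin 4 → Site (d + 1)) s ((![κ, a, a, κ] : Fin 4 → Fin (d + 1)) s) % (N : ℤ) = (N : ℤ) - 1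
              then (1 : ℝ) else 0))) * Y κ (toSite rr) a u' x z (Sum.inl α) (Sum.inl β)
        + ∑ rr ∈ box (d + 1) N, ∑' u' : Site (d + 1), ∑' x : Site (d + 1), ∑' z : Site (d + 1),
            (∏ s ∈ ({1, 2} : Finset (Fin 4)), (1 - (N : ℝ) * (if (![toSite rr, u', x, z] : Fin 4 → Site (d + 1)) s ((![κ, a, a, κ] : Fin 4 → Fin (d + 1)) s) % (N : ℤ) = (N : ℤ) - 1
              then (1 : ℝ) else 0))) * Y κ (toSite rr) a u' x z (Sum.inl α) (Sum.inl β)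
        + ∑ rr ∈ box (d + 1) N, ∑' u' : Site (d + 1), ∑' x : Site (d + 1), ∑' z : Site (d + 1),
            (∏ s ∈ (Finset.univ : Finset (Fin 4)), (1 - (N : ℝ) * (if (![toSite rr, u', x, z] : Fin 4 → Site (d + 1)) s ((![κ, a, a, κ] : Fin 4 → Fin (d + 1)) s) % (N : ℤ) = (N : ℤ) - 1
              then (1 : ℝ) else 0))) * Y κ (toSite rr) a u' x z (Sum.inl α) (Sum.inl β) := by
  rw [fourFace_mul_eq_sum_sectors hN hY hδ h1 κ a a κ α β,
    sum_powerset_eq_sum_of_vanish _ ({∅, {0, 3}, {1, 2}, Finset.univ} : Finset (Finset (Fin 4))) ?van]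
  · rw [Finset.sum_insert (by decide), Finset.sum_insert (by decide), Finset.sum_insert (by decide), Finset.sum_singleton,
      sector_empty]
    have c01 : (({0, 3} : Finset (Fin 4)).card : ℕ) = 2 := by decide
    have c23 : (({1, 2} : Finset (Fin 4)).card : ℕ) = 2 := by decide
    rw [Finset.card_empty, c01, c23, Finset.card_univ, Fintype.card_fin, pow_zero, neg_one_sq, show ((-1 : ℝ)) ^ 4 = 1 by norm_num]
    simp only [one_mul, add_assoc]
  · intro S hS
    obtain ⟨s₀, hs₀, hl⟩ := lonely_of_pairs_03_12 S hS
    rw [sector_eq_zero_of_lonely hN hY hδ h1 κ a a κ α β S hs₀ (fun s hs h => hl s hs (class_of_dir_pairs_swap hκa s s₀ h)), mul_zero]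

/-! ## §3 The comb member: Part 1 at every level -/

/-- NOT IN PRINT; OUR BOOKKEEPING.  **THE FOUR-FACE CHARGE OF THE COMB MEMBER IN PURE-GAUGE SECTORS, EVERY LEVEL** (`1 ≤ Lc`, in-block root, generic off-diagonal
jointly `Lc`-covariant `LocStencil₂` border): Part 1's `fourFace_mul_eq_sum_sectors` for `Y := T̃_j = unitS₂_j (T2RecAt … j)` at the period `N := Lc` — the left-hand side is
LITERALLY the four-face term of p2's `T2RecChargeStepFourFace.zmode_succ_eq_fourFace` (pattern `(μ,ν;α,β)`, legs' face directions = their fibre indices). -/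
theorem member_fourFace_mul_eq_sum_sectors (hLc : 1 ≤ Lc) (hr : r ∈ box (d + 1) Lc) (cE cVH cΛ cE₂ cB : ℝ) (Tc : Fin 4 → Fin 4 → Fin 4 → Fin 4 → ℝ)
    {vh₂S : Tab d} (hBff : ∀ κ u κ' u' x z (α β : Fin (d + 1)), vh₂S κ u κ' u' x z (Sum.inl α) (Sum.inl β) = 0)
    (hB : ∃ C δ : ℝ, 0 < δ ∧ LocStencil₂ vh₂S C δ)
    (hBt : ∀ (κ : Fin (d + 1)) (u : Fin (d + 1) → ℤ) (κ' : Fin (d + 1)) (u' t : Fin (d + 1) → ℤ),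
      vh₂S κ (u + (Lc : ℤ) • t) κ' (u' + (Lc : ℤ) • t) = shiftK (-((Lc : ℤ) • t)) (vh₂S κ u κ' u'))
    (j : ℕ) (μ ν α β : Fin (d + 1)) :
    (Lc : ℝ) ^ 4 * ∑ r' ∈ box (d + 1) Lc, ∑' u' : Site (d + 1), ∑' x : Site (d + 1), ∑' z : Site (d + 1),
        (if toSite r' μ % (Lc : ℤ) = (Lc : ℤ) - 1 ∧ u' ν % (Lc : ℤ) = (Lc : ℤ) - 1 ∧ x α % (Lc : ℤ) = (Lc : ℤ) - 1 ∧ z β % (Lc : ℤ) = (Lc : ℤ) - 1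
          then unitS₂ (sfStep Lc j) (smStep d Lc j) (T2RecAt d Lc (toSite r) cE cVH cΛ cE₂ cB Tc vh₂S (mixFFAt (toSite r) Lc) j)
            μ (toSite r') ν u' x z (Sum.inl α) (Sum.inl β) else 0)
      = ∑ S ∈ (Finset.univ : Finset (Fin 4)).powerset, (-1 : ℝ) ^ S.card *
          ∑ r' ∈ box (d + 1) Lc, ∑' u' : Site (d + 1), ∑' x : Site (d + 1), ∑' z : Site (d + 1),
            (∏ s ∈ S, (1 - (Lc : ℝ) * (if (![toSite r', u', x, z] : Fin 4 → Site (d + 1)) s ((![μ, ν, α, β] : Fin 4 → Fin (d + 1)) s) % (Lc : ℤ) = (Lc : ℤ) - 1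
              then (1 : ℝ) else 0)))
            * unitS₂ (sfStep Lc j) (smStep d Lc j) (T2RecAt d Lc (toSite r) cE cVH cΛ cE₂ cB Tc vh₂S (mixFFAt (toSite r) Lc) j)
                μ (toSite r') ν u' x z (Sum.inl α) (Sum.inl β) := by
  obtain ⟨CT, δT, hδT, hT⟩ := shape_member hLc hr cE cVH cΛ cE₂ cB Tc hB j
  exact fourFace_mul_eq_sum_sectors hLc hT hδT (member_ff_translate hLc cE cVH cΛ cE₂ cB Tc hBff hBt j) μ ν α β α β

/-- NOT IN PRINT; OUR BOOKKEEPING.  **EVERY LONELY SECTOR OF THE COMB MEMBER VANISHES, EVERY LEVEL**: Part 1's `sector_eq_zero_of_lonely` for `Y := T̃_j`, `N := Lc` —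
«one pure-gauge insertion never charges the member's contact table; mixed pairs vanish» (the engine's t2 anatomy, memo §5c, at every `j`). -/
theorem member_sector_eq_zero_of_lonely (hLc : 1 ≤ Lc) (hr : r ∈ box (d + 1) Lc) (cE cVH cΛ cE₂ cB : ℝ) (Tc : Fin 4 → Fin 4 → Fin 4 → Fin 4 → ℝ)
    {vh₂S : Tab d} (hBff : ∀ κ u κ' u' x z (α β : Fin (d + 1)), vh₂S κ u κ' u' x z (Sum.inl α) (Sum.inl β) = 0)
    (hB : ∃ C δ : ℝ, 0 < δ ∧ LocStencil₂ vh₂S C δ)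
    (hBt : ∀ (κ : Fin (d + 1)) (u : Fin (d + 1) → ℤ) (κ' : Fin (d + 1)) (u' t : Fin (d + 1) → ℤ),
      vh₂S κ (u + (Lc : ℤ) • t) κ' (u' + (Lc : ℤ) • t) = shiftK (-((Lc : ℤ) • t)) (vh₂S κ u κ' u'))
    (j : ℕ) (μ ν α β : Fin (d + 1)) (S : Finset (Fin 4)) {s₀ : Fin 4} (hs₀ : s₀ ∈ S)
    (hlone : ∀ s ∈ S, (![μ, ν, α, β] : Fin 4 → Fin (d + 1)) s = (![μ, ν, α, β] : Fin 4 → Fin (d + 1)) s₀ → s = s₀) :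
    ∑ r' ∈ box (d + 1) Lc, ∑' u' : Site (d + 1), ∑' x : Site (d + 1), ∑' z : Site (d + 1),
        (∏ s ∈ S, (1 - (Lc : ℝ) * (if (![toSite r', u', x, z] : Fin 4 → Site (d + 1)) s ((![μ, ν, α, β] : Fin 4 → Fin (d + 1)) s) % (Lc : ℤ) = (Lc : ℤ) - 1
          then (1 : ℝ) else 0)))
        * unitS₂ (sfStep Lc j) (smStep d Lc j) (T2RecAt d Lc (toSite r) cE cVH cΛ cE₂ cB Tc vh₂S (mixFFAt (toSite r) Lc) j)
            μ (toSite r') ν u' x z (Sum.inl α) (Sum.inl β) = 0 := by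
  obtain ⟨CT, δT, hδT, hT⟩ := shape_member hLc hr cE cVH cΛ cE₂ cB Tc hB j
  exact sector_eq_zero_of_lonely hLc hT hδT (member_ff_translate hLc cE cVH cΛ cE₂ cB Tc hBff hBt j) μ ν α β α β S hs₀ hlone

/-- NOT IN PRINT; OUR BOOKKEEPING.  **THE WILSON-CHARGED PATTERNS `(μ,μ;α,α)`, `μ ≠ α`, OF THE COMB MEMBER, EVERY LEVEL**: `Lc⁴·FF_Lc(T̃_j)(μ,μ;α,α) =
zmode Lc T̃_j μ μ (inl α) (inl α) + Sector_{{0,1}}(T̃_j) + Sector_{{2,3}}(T̃_j) + Sector_{{0,1,2,3}}(T̃_j)` — the background pair `T̃_j[dλ_μ, dλ_μ; c̃, c̃]`, the leg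
pair `T̃_j[c̃, c̃; dλ_α, dλ_α]` and the four-insertion sector (§2 at `Y := T̃_j`; the crossed and swapped classes `(μ,ν;μ,ν)`, `(μ,ν;ν,μ)` likewise from
`fourFace_mul_eq_of_pairs_cross ∕ _swap`).  With p2's `zfreeSym_sourceB_iff` this is the located form of (C)_j on these patterns: the dressed source's
symmetrised charge against EXACTLY these three sectors (docstring reading, NOT asserted). -/
theorem member_fourFace_mul_eq_of_pairs_bg_leg (hLc : 1 ≤ Lc) (hr : r ∈ box (d + 1) Lc) (cE cVH cΛ cE₂ cB : ℝ) (Tc : Fin 4 → Fin 4 → Fin 4 → Fin 4 → ℝ)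
    {vh₂S : Tab d} (hBff : ∀ κ u κ' u' x z (α β : Fin (d + 1)), vh₂S κ u κ' u' x z (Sum.inl α) (Sum.inl β) = 0)
    (hB : ∃ C δ : ℝ, 0 < δ ∧ LocStencil₂ vh₂S C δ)
    (hBt : ∀ (κ : Fin (d + 1)) (u : Fin (d + 1) → ℤ) (κ' : Fin (d + 1)) (u' t : Fin (d + 1) → ℤ),
      vh₂S κ (u + (Lc : ℤ) • t) κ' (u' + (Lc : ℤ) • t) = shiftK (-((Lc : ℤ) • t)) (vh₂S κ u κ' u'))
    (j : ℕ) {μ α : Fin (d + 1)} (hμα : μ ≠ α) :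
    (Lc : ℝ) ^ 4 * ∑ r' ∈ box (d + 1) Lc, ∑' u' : Site (d + 1), ∑' x : Site (d + 1), ∑' z : Site (d + 1),
        (if toSite r' μ % (Lc : ℤ) = (Lc : ℤ) - 1 ∧ u' μ % (Lc : ℤ) = (Lc : ℤ) - 1 ∧ x α % (Lc : ℤ) = (Lc : ℤ) - 1 ∧ z α % (Lc : ℤ) = (Lc : ℤ) - 1
          then unitS₂ (sfStep Lc j) (smStep d Lc j) (T2RecAt d Lc (toSite r) cE cVH cΛ cE₂ cB Tc vh₂S (mixFFAt (toSite r) Lc) j)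
            μ (toSite r') μ u' x z (Sum.inl α) (Sum.inl α) else 0)
      = zmode Lc (unitS₂ (sfStep Lc j) (smStep d Lc j) (T2RecAt d Lc (toSite r) cE cVH cΛ cE₂ cB Tc vh₂S (mixFFAt (toSite r) Lc) j)) μ μ (Sum.inl α) (Sum.inl α)
        + ∑ r' ∈ box (d + 1) Lc, ∑' u' : Site (d + 1), ∑' x : Site (d + 1), ∑' z : Site (d + 1),
            (∏ s ∈ ({0, 1} : Finset (Fin 4)), (1 - (Lc : ℝ) * (if (![toSite r', u', x, z] : Fin 4 → Site (d + 1)) s ((![μ, μ, α, α] : Fin 4 → Fin (d + 1)) s) % (Lc : ℤ) = (Lc : ℤ) - 1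
              then (1 : ℝ) else 0)))
            * unitS₂ (sfStep Lc j) (smStep d Lc j) (T2RecAt d Lc (toSite r) cE cVH cΛ cE₂ cB Tc vh₂S (mixFFAt (toSite r) Lc) j)
                μ (toSite r') μ u' x z (Sum.inl α) (Sum.inl α)
        + ∑ r' ∈ box (d + 1) Lc, ∑' u' : Site (d + 1), ∑' x : Site (d + 1), ∑' z : Site (d + 1),
            (∏ s ∈ ({2, 3} : Finset (Fin 4)), (1 - (Lc : ℝ) * (if (![toSite r', u', x, z] : Fin 4 → Site (d + 1)) s ((![μ, μ, α, α] : Fin 4 → Fin (d + 1)) s) % (Lc : ℤ) = (Lc : ℤ) - 1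
              then (1 : ℝ) else 0)))
            * unitS₂ (sfStep Lc j) (smStep d Lc j) (T2RecAt d Lc (toSite r) cE cVH cΛ cE₂ cB Tc vh₂S (mixFFAt (toSite r) Lc) j)
                μ (toSite r') μ u' x z (Sum.inl α) (Sum.inl α)
        + ∑ r' ∈ box (d + 1) Lc, ∑' u' : Site (d + 1), ∑' x : Site (d + 1), ∑' z : Site (d + 1),
            (∏ s ∈ (Finset.univ : Finset (Fin 4)), (1 - (Lc : ℝ) * (if (![toSite r', u', x, z] : Fin 4 → Site (d + 1)) s ((![μ, μ, α, α] : Fin 4 → Fin (d + 1)) s) % (Lc : ℤ) = (Lc : ℤ) - 1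
              then (1 : ℝ) else 0)))
            * unitS₂ (sfStep Lc j) (smStep d Lc j) (T2RecAt d Lc (toSite r) cE cVH cΛ cE₂ cB Tc vh₂S (mixFFAt (toSite r) Lc) j)
                μ (toSite r') μ u' x z (Sum.inl α) (Sum.inl α) := by
  obtain ⟨CT, δT, hδT, hT⟩ := shape_member hLc hr cE cVH cΛ cE₂ cB Tc hB j
  exact fourFace_mul_eq_of_pairs_bg_leg hLc hT hδT (member_ff_translate hLc cE cVH cΛ cE₂ cB Tc hBff hBt j) hμα α α

end Summit.QuantumFields.BalabanUV.Beta.GAN24.FourFaceGaugeSectorsMember
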